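import Mathlib
import Summits.KontsevichZagierPeriods.KontsevichZagierPeriods.Theorems.IsogenyCertificatesRichelotChainCerts
import Summits.KontsevichZagierPeriods.KontsevichZagierPeriods.Theorems.IsogenyCertificatesRichelotChainCorr

/-!
# `RichelotChain` (stmt-KontsevichZagierPeriods-6732): the interval `(34, 36) ↔ (30, 40)`

Fourth bounded root intervals of `Ĉ : w² = F̂(z) = (z+15)(z−9)(z−10)(z−34)(z−36)(z−60)` and
`C : y² = F(x) = x(x−6)(x−13)(x−30)(x−40)(x−45)` (`F̂ > 0`, `F > 0` there: real ovals):
`[(34,36), (α+βz)/√|F̂|] ~ [(30,40), ½(α+βx)/√|F|]`. As for `k = 1` the source is the `C`-side: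
the two real sheets of `Z₁ : Φ⁰(x,z) = 0` over `x ∈ (30,34)` and `x ∈ (34,40)` are the SMALLER
`z`-root of `Φ⁰(x,·)` (the larger lies in `(60,67)`), each mapping onto `(34,36)`; the trace of
`dx/y` over the two `x`-roots is `2·dz/w` (`cert0_trace_z`). Interval-specific sign bookkeeping:
`disc_z Φ⁰ = 8x(11x−170)(23x−650)(45−x)`, `Φ⁰(x,34) = 650(x−34)²`, `Φ⁰(x,36) = 702(x−30)(x−40)`,
`Φ⁰(x,60) = 1950(x−30)(x−40)`, `Φ⁰(x,67) = 2531x² − 171745x + 2917850 > 0`,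
`Φ⁰(30,z) = 200(z−36)(z−60)`, `Φ⁰(34,z) = 12(z−34)(23z−1530)`, `Φ⁰(z,z) = z(z−45)(z−10)(z−34)`,
`Φ⁰(40,z) = 450(z−36)(z−60)`.

References: J.-B. Bost, J.-F. Mestre, Gaz. Math. 38 (1988), §2; M. Kontsevich, D. Zagier, *Periods*
(2001), §1.2.
-/

noncomputable section

open Set MeasureTheory
open Literature.NumberTheory.Transcendental Literature.ModelTheory.ExponentialFields

namespace Summit.KontsevichZagierPeriods.IsogenyCertificates.RichelotChain

/-- **`RichelotChain`, interval `k = 3`:** `[(34,36), (α+βz)/√|F̂|] ~ [(30,40), ½(α+βx)/√|F|]`.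
[cite: BostMestre1988, §2] -/
theorem sheet_k3 (α β : ℚ) (r r' : KZ.IntegralRep 1)
    (h1 : r.domain = {z | (34 : ℝ) < z 0 ∧ z 0 < 36})
    (h2 : EqOn r.integrand (fun z => ((α : ℝ) + (β : ℝ) * z 0) /
      Real.sqrt |(z 0 + 15) * (z 0 - 9) * (z 0 - 10) * (z 0 - 34) * (z 0 - 36) * (z 0 - 60)|) r.domain)
    (h3 : r'.domain = {x | (30 : ℝ) < x 0 ∧ x 0 < 40})
    (h4 : EqOn r'.integrand (fun x => (1 / 2 : ℝ) * ((α : ℝ) + (β : ℝ) * x 0) /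
      Real.sqrt |x 0 * (x 0 - 6) * (x 0 - 13) * (x 0 - 30) * (x 0 - 40) * (x 0 - 45)|) r'.domain) :
    KZ.Equivalent r r' := by
  -- the data of the correspondence `Z₁`, in the `z`-root direction (source `t = x`, target `y = z`)
  set a : ℝ → ℝ := fun t => t ^ 2 - 45 * t + 650 with ha_def
  set b : ℝ → ℝ := fun t => -44 * t ^ 2 + 680 * t with hb_def
  set c : ℝ → ℝ := fun t => 990 * t ^ 2 - 15300 * t with hc_def
  set a₁ : ℝ → ℝ := fun t => 2 * t - 45 with ha₁_def
  set b₁ : ℝ → ℝ := fun t => -88 * t + 680 with hb₁_def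
  set c₁ : ℝ → ℝ := fun t => 1980 * t - 15300 with hc₁_def
  set P : ℝ → ℝ := fun y => y ^ 2 - 44 * y + 990 with hP_def
  set Q : ℝ → ℝ := fun y => -45 * y ^ 2 + 680 * y - 15300 with hQ_def
  set R : ℝ → ℝ := fun y => 650 * y ^ 2 with hR_def
  set Ft : ℝ → ℝ := fun y => (y + 15) * (y - 9) * (y - 10) * (y - 34) * (y - 36) * (y - 60) with hFt_def
  set Fs : ℝ → ℝ := fun t => t * (t - 6) * (t - 13) * (t - 30) * (t - 40) * (t - 45) with hFs_def
  set Ψ : ℝ → ℝ → ℝ := fun y t => 25 * (t - 6) * (t - 13) * (y - 36) * (y - 60) * (t - y) with hΨ_def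
  have defs : (∀ t, a t = t ^ 2 - 45 * t + 650) ∧ (∀ t, b t = -44 * t ^ 2 + 680 * t) ∧
      (∀ t, c t = 990 * t ^ 2 - 15300 * t) ∧ (∀ t, a₁ t = 2 * t - 45) ∧ (∀ t, b₁ t = -88 * t + 680) ∧
      (∀ t, c₁ t = 1980 * t - 15300) ∧ (∀ y, P y = y ^ 2 - 44 * y + 990) ∧
      (∀ y, Q y = -45 * y ^ 2 + 680 * y - 15300) ∧ (∀ y, R y = 650 * y ^ 2) ∧
      (∀ y, Ft y = (y + 15) * (y - 9) * (y - 10) * (y - 34) * (y - 36) * (y - 60)) ∧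
      (∀ t, Fs t = t * (t - 6) * (t - 13) * (t - 30) * (t - 40) * (t - 45)) ∧
      (∀ y t, Ψ y t = 25 * (t - 6) * (t - 13) * (y - 36) * (y - 60) * (t - y)) :=
    ⟨fun _ => rfl, fun _ => rfl, fun _ => rfl, fun _ => rfl, fun _ => rfl, fun _ => rfl, fun _ => rfl,
      fun _ => rfl, fun _ => rfl, fun _ => rfl, fun _ => rfl, fun _ _ => rfl⟩
  obtain ⟨ea, eb, ec, ea₁, eb₁, ec₁, eP, eQ, eR, eFt, eFs, eΨ⟩ := defs
  -- hypotheses of `correspondence_transfer`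
  have hexp : ∀ y t : ℝ, a t * y ^ 2 + b t * y + c t = P y * t ^ 2 + Q y * t + R y := by
    intro y t; rw [ea, eb, ec, eP, eQ, eR]; ring
  have hda : ∀ t, HasDerivAt a (a₁ t) t := fun t =>
    (hasDerivAt_quad 1 (-45) 650 t (fun u => by rw [ea]; ring)).congr_deriv (by rw [ea₁]; ring)
  have hdb : ∀ t, HasDerivAt b (b₁ t) t := fun t =>
    (hasDerivAt_quad (-44) 680 0 t (fun u => by rw [eb]; ring)).congr_deriv (by rw [eb₁]; ring)
  have hdc : ∀ t, HasDerivAt c (c₁ t) t := fun t =>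
    (hasDerivAt_quad 990 (-15300) 0 t (fun u => by rw [ec]; ring)).congr_deriv (by rw [ec₁]; ring)
  have hsa : ∀ σ : Set (Fin 1 → ℝ), IsSemialgebraic ℚ σ → IsSemialgebraicFunOn ℚ σ (fun p => a (p 0)) :=
    fun σ hσ => poly_semialgebraic hσ (MvPolynomial.X 0 ^ 2 - 45 * MvPolynomial.X 0 + 650) a
      (fun x => by rw [ea]; simp)
  have hsb : ∀ σ : Set (Fin 1 → ℝ), IsSemialgebraic ℚ σ → IsSemialgebraicFunOn ℚ σ (fun p => b (p 0)) :=
    fun σ hσ => poly_semialgebraic hσ (-44 * MvPolynomial.X 0 ^ 2 + 680 * MvPolynomial.X 0) b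
      (fun x => by rw [eb]; simp)
  have hsc : ∀ σ : Set (Fin 1 → ℝ), IsSemialgebraic ℚ σ → IsSemialgebraicFunOn ℚ σ (fun p => c (p 0)) :=
    fun σ hσ => poly_semialgebraic hσ (990 * MvPolynomial.X 0 ^ 2 - 15300 * MvPolynomial.X 0) c
      (fun x => by rw [ec]; simp)
  have hsa₁ : ∀ σ : Set (Fin 1 → ℝ), IsSemialgebraic ℚ σ → IsSemialgebraicFunOn ℚ σ (fun p => a₁ (p 0)) :=
    fun σ hσ => poly_semialgebraic hσ (2 * MvPolynomial.X 0 - 45) a₁ (fun x => by rw [ea₁]; simp)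
  have hsb₁ : ∀ σ : Set (Fin 1 → ℝ), IsSemialgebraic ℚ σ → IsSemialgebraicFunOn ℚ σ (fun p => b₁ (p 0)) :=
    fun σ hσ => poly_semialgebraic hσ (-88 * MvPolynomial.X 0 + 680) b₁ (fun x => by rw [eb₁]; simp)
  have hsc₁ : ∀ σ : Set (Fin 1 → ℝ), IsSemialgebraic ℚ σ → IsSemialgebraicFunOn ℚ σ (fun p => c₁ (p 0)) :=
    fun σ hσ => poly_semialgebraic hσ (1980 * MvPolynomial.X 0 - 15300) c₁ (fun x => by rw [ec₁]; simp)
  have hΦP : ∀ y t : ℝ, a t * y ^ 2 + b t * y + c t = 0 →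
      (t ^ 2 - 45 * t + 650) * y ^ 2 + (-44 * t ^ 2 + 680 * t) * y + (990 * t ^ 2 - 15300 * t) = 0 := by
    intro y t h; rw [ea, eb, ec] at h; linear_combination h
  have hnorm : ∀ y t : ℝ, a t * y ^ 2 + b t * y + c t = 0 → Ft y * Fs t = Ψ y t ^ 2 := by
    intro y t h
    have c0 := cert0_norm t y
    rw [hΦP y t h, zero_mul, sub_eq_zero] at c0
    rw [eFt, eFs, eΨ]
    linear_combination c0
  have hcert : ∀ y t : ℝ, a t * y ^ 2 + b t * y + c t = 0 →
      Ft y * (2 * a t * y + b t) + 2 * (P y * (y + t) + Q y) * Ψ y t = 0 := by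
    intro y t h
    have c0 := cert0_trace_z t y
    rw [hΦP y t h, zero_mul] at c0
    rw [eFt, ea, eb, eP, eQ, eΨ]
    linear_combination c0
  have ha : ∀ t : ℝ, ((30 : ℚ) : ℝ) < t → t < ((40 : ℚ) : ℝ) → 0 < a t := by
    intro t _ _; rw [ea]; nlinarith [sq_nonneg (2 * t - 45)]
  have hd : ∀ t : ℝ, ((30 : ℚ) : ℝ) < t → t < ((40 : ℚ) : ℝ) → t ≠ ((34 : ℚ) : ℝ) →
      0 < b t ^ 2 - 4 * a t * c t := by
    intro t h1 h2 _
    push_cast at h1 h2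
    rw [ea, eb, ec, show (-44 * t ^ 2 + 680 * t) ^ 2 - 4 * (t ^ 2 - 45 * t + 650) * (990 * t ^ 2 - 15300 * t) =
      8 * t * (11 * t - 170) * (23 * t - 650) * (45 - t) by ring]
    exact mul_pos (mul_pos (mul_pos (mul_pos (by norm_num) (by linarith)) (by linarith)) (by linarith))
      (by linarith)
  -- the quadratic in `z` over a point `t = x` of the source: continuity and values at 34, 36, 60, 67
  have hcx : ∀ t : ℝ, Continuous (fun y : ℝ => a t * y ^ 2 + b t * y + c t) := by
    intro t; rw [ea, eb, ec]; fun_prop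
  have hv34 : ∀ t : ℝ, a t * (34 : ℝ) ^ 2 + b t * 34 + c t = 650 * (t - 34) ^ 2 := by
    intro t; rw [ea, eb, ec]; ring
  have hv36 : ∀ t : ℝ, a t * (36 : ℝ) ^ 2 + b t * 36 + c t = 702 * (t - 30) * (t - 40) := by
    intro t; rw [ea, eb, ec]; ring
  have hv60 : ∀ t : ℝ, a t * (60 : ℝ) ^ 2 + b t * 60 + c t = 1950 * (t - 30) * (t - 40) := by
    intro t; rw [ea, eb, ec]; ring
  have hv67 : ∀ t : ℝ, a t * (67 : ℝ) ^ 2 + b t * 67 + c t = 2531 * t ^ 2 - 171745 * t + 2917850 := by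
    intro t; rw [ea, eb, ec]; ring
  have hyroots : ∀ t : ℝ, ((30 : ℚ) : ℝ) < t → t < ((40 : ℚ) : ℝ) → t ≠ ((34 : ℚ) : ℝ) →
      (∃ y : ℝ, ((34 : ℚ) : ℝ) < y ∧ y < ((36 : ℚ) : ℝ) ∧ a t * y ^ 2 + b t * y + c t = 0) ∧
        ∃ y' : ℝ, ((60 : ℚ) : ℝ) < y' ∧ y' < ((67 : ℚ) : ℝ) ∧ a t * y' ^ 2 + b t * y' + c t = 0 := by
    intro t ht1 ht2 ht0
    push_cast at ht1 ht2 ht0 ⊢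
    have hneg : (t - 30) * (t - 40) < 0 := mul_neg_of_pos_of_neg (by linarith) (by linarith)
    have hsq : 0 < (t - 34) ^ 2 := by
      have : t - 34 ≠ 0 := sub_ne_zero.mpr ht0
      positivity
    constructor
    · have h0 : (0 : ℝ) ∈ Ioo (a t * (36 : ℝ) ^ 2 + b t * 36 + c t) (a t * (34 : ℝ) ^ 2 + b t * 34 + c t) := by
        rw [hv34, hv36]
        exact ⟨by nlinarith, by nlinarith⟩
      obtain ⟨y, hy, hy0⟩ := intermediate_value_Ioo' (show (34 : ℝ) ≤ 36 by norm_num) (hcx t).continuousOn h0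
      exact ⟨y, hy.1, hy.2, hy0⟩
    · have h0 : (0 : ℝ) ∈ Ioo (a t * (60 : ℝ) ^ 2 + b t * 60 + c t) (a t * (67 : ℝ) ^ 2 + b t * 67 + c t) := by
        rw [hv60, hv67]
        exact ⟨by nlinarith, by nlinarith [sq_nonneg (5062 * t - 171745)]⟩
      obtain ⟨y, hy, hy0⟩ := intermediate_value_Ioo (show (60 : ℝ) ≤ 67 by norm_num) (hcx t).continuousOn h0
      exact ⟨y, hy.1, hy.2, hy0⟩
  have hsep : ∀ y y' : ℝ, ((34 : ℚ) : ℝ) < y → y < ((36 : ℚ) : ℝ) → ((60 : ℚ) : ℝ) < y' → y' < ((67 : ℚ) : ℝ) →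
      0 < (((-1 : ℚ)) : ℝ) * (y - y') := by
    intro y y' _ hy hy' _
    push_cast at hy hy' ⊢
    nlinarith
  have hP : ∀ y : ℝ, ((34 : ℚ) : ℝ) < y → y < ((36 : ℚ) : ℝ) → P y ≠ 0 := by
    intro y _ _; rw [eP]; nlinarith [sq_nonneg (y - 22)]
  -- the quadratic in `t = x` over a point `y = z` of the target: continuity and values at 30, 34, y, 40
  have hct : ∀ y : ℝ, Continuous (fun t : ℝ => a t * y ^ 2 + b t * y + c t) := by
    intro y; simp only [ea, eb, ec]; fun_prop
  have hw30 : ∀ y : ℝ, a 30 * y ^ 2 + b 30 * y + c 30 = 200 * (y - 36) * (y - 60) := by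
    intro y; rw [ea, eb, ec]; ring
  have hw34 : ∀ y : ℝ, a 34 * y ^ 2 + b 34 * y + c 34 = 12 * (y - 34) * (23 * y - 1530) := by
    intro y; rw [ea, eb, ec]; ring
  have hwy : ∀ y : ℝ, a y * y ^ 2 + b y * y + c y = y * (y - 45) * (y - 10) * (y - 34) := by
    intro y; rw [ea, eb, ec]; ring
  have hw40 : ∀ y : ℝ, a 40 * y ^ 2 + b 40 * y + c 40 = 450 * (y - 36) * (y - 60) := by
    intro y; rw [ea, eb, ec]; ring
  have htroots : ∀ y : ℝ, ((34 : ℚ) : ℝ) < y → y < ((36 : ℚ) : ℝ) →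
      (∃ t : ℝ, ((30 : ℚ) : ℝ) < t ∧ t < ((34 : ℚ) : ℝ) ∧ t < y ∧ a t * y ^ 2 + b t * y + c t = 0) ∧
        ∃ t : ℝ, ((34 : ℚ) : ℝ) < t ∧ t < ((40 : ℚ) : ℝ) ∧ y < t ∧ a t * y ^ 2 + b t * y + c t = 0 := by
    intro y hy1 hy2
    push_cast at hy1 hy2 ⊢
    have hpos : 0 < (y - 36) * (y - 60) := mul_pos_of_neg_of_neg (by linarith) (by linarith)
    constructor
    · -- a root in (30, 34): Φ⁰(30,z) = 200(z−36)(z−60) > 0 > Φ⁰(34,z) = 12(z−34)(23z−1530)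
      have h0 : (0 : ℝ) ∈ Ioo (a 34 * y ^ 2 + b 34 * y + c 34) (a 30 * y ^ 2 + b 30 * y + c 30) := by
        rw [hw30, hw34]
        refine ⟨?_, by nlinarith⟩
        nlinarith [mul_pos (by linarith : (0 : ℝ) < y - 34) (by linarith : (0 : ℝ) < 1530 - 23 * y)]
      obtain ⟨t, ht, ht0⟩ := intermediate_value_Ioo' (show (30 : ℝ) ≤ 34 by norm_num) (hct y).continuousOn h0
      exact ⟨t, ht.1, ht.2, by linarith [ht.2], ht0⟩
    · -- a root in (y, 40): Φ⁰(z,z) = z(z−45)(z−10)(z−34) < 0 < Φ⁰(40,z) = 450(z−36)(z−60)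
      have h0 : (0 : ℝ) ∈ Ioo (a y * y ^ 2 + b y * y + c y) (a 40 * y ^ 2 + b 40 * y + c 40) := by
        rw [hwy, hw40]
        refine ⟨?_, by nlinarith⟩
        have h1 : 0 < y * (45 - y) := mul_pos (by linarith) (by linarith)
        have h2 : 0 < (y - 10) * (y - 34) := mul_pos (by linarith) (by linarith)
        nlinarith [mul_pos h1 h2]
      obtain ⟨t, ht, ht0⟩ := intermediate_value_Ioo (show y ≤ 40 by linarith) (hct y).continuousOn h0
      exact ⟨t, by linarith [ht.1], ht.2, ht.1, ht0⟩
  have hDz : ∀ y : ℝ, ((34 : ℚ) : ℝ) < y → y < ((36 : ℚ) : ℝ) → Q y ^ 2 - 4 * P y * R y ≠ 0 := by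
    intro y hy1 hy2
    push_cast at hy1 hy2
    rw [eP, eQ, eR, show (-45 * y ^ 2 + 680 * y - 15300) ^ 2 - 4 * (y ^ 2 - 44 * y + 990) * (650 * y ^ 2) =
      -25 * (y + 18) * (y - 10) * (y - 34) * (23 * y - 1530) by ring]
    refine mul_ne_zero (mul_ne_zero (mul_ne_zero (mul_ne_zero (by norm_num) ?_) ?_) ?_) ?_
    · exact (by linarith : (0 : ℝ) < y + 18).ne'
    · exact (by linarith : (0 : ℝ) < y - 10).ne'
    · exact (by linarith : (0 : ℝ) < y - 34).ne'
    · exact (by linarith : 23 * y - 1530 < 0).ne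
  have hFt : ∀ y : ℝ, ((34 : ℚ) : ℝ) < y → y < ((36 : ℚ) : ℝ) → Ft y ≠ 0 := by
    intro y hy1 hy2
    push_cast at hy1 hy2
    rw [eFt]
    refine mul_ne_zero (mul_ne_zero (mul_ne_zero (mul_ne_zero (mul_ne_zero ?_ ?_) ?_) ?_) ?_) ?_
    · exact (by linarith : (0 : ℝ) < y + 15).ne'
    · exact (by linarith : (0 : ℝ) < y - 9).ne'
    · exact (by linarith : (0 : ℝ) < y - 10).ne'
    · exact (by linarith : (0 : ℝ) < y - 34).ne'
    · exact (by linarith : y - 36 < 0).ne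
    · exact (by linarith : y - 60 < 0).ne
  have hFs : ∀ t : ℝ, ((30 : ℚ) : ℝ) < t → t < ((40 : ℚ) : ℝ) → t ≠ ((34 : ℚ) : ℝ) → Fs t ≠ 0 := by
    intro t ht1 ht2 _
    push_cast at ht1 ht2
    rw [eFs]
    refine mul_ne_zero (mul_ne_zero (mul_ne_zero (mul_ne_zero (mul_ne_zero ?_ ?_) ?_) ?_) ?_) ?_
    · exact (by linarith : (0 : ℝ) < t).ne'
    · exact (by linarith : (0 : ℝ) < t - 6).ne'
    · exact (by linarith : (0 : ℝ) < t - 13).ne'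
    · exact (by linarith : (0 : ℝ) < t - 30).ne'
    · exact (by linarith : t - 40 < 0).ne
    · exact (by linarith : t - 45 < 0).ne
  have hr : r'.domain = {p | ((30 : ℚ) : ℝ) < p 0 ∧ p 0 < ((40 : ℚ) : ℝ)} := by push_cast; exact h3
  have hs : r.domain = {p | ((34 : ℚ) : ℝ) < p 0 ∧ p 0 < ((36 : ℚ) : ℝ)} := by push_cast; exact h1
  have hg : EqOn r'.integrand (fun p => (1 / 2) * ((α : ℝ) + (β : ℝ) * p 0) / Real.sqrt |Fs (p 0)|) r'.domain := by
    intro p hp; rw [h4 hp]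
  have hf : EqOn r.integrand (fun p => 1 * ((α : ℝ) + (β : ℝ) * p 0) / Real.sqrt |Ft (p 0)|) r.domain := by
    intro p hp; rw [h2 hp]; beta_reduce; rw [eFt, one_mul]
  exact (correspondence_transfer a b c a₁ b₁ c₁ P Q R Ft Fs Ψ 2 1 (1 / 2) (α : ℝ) (β : ℝ) (-1) 30 34 40 34 36 60 67
    r' r (Or.inl rfl) (by norm_num) (by norm_num) hexp hda hdb hdc hsa hsb hsc hsa₁ hsb₁ hsc₁ hnorm hcert
    (by norm_num) ha hd hyroots hsep hP htroots hDz hFt hFs hr hg hs hf).symm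

end Summit.KontsevichZagierPeriods.IsogenyCertificates.RichelotChain

end
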